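import Literature.MathematicalPhysics.QuantumFieldTheory.Balaban1983to89.Node00.TorusCoverGaugeLiftShift
import Literature.MathematicalPhysics.QuantumFieldTheory.Balaban1983to89.B8Eq138LandauFlatOrthogonalRec
import Literature.MathematicalPhysics.QuantumFieldTheory.Balaban1983to89.Node00.TorusCoverLandau153TestForm
import Literature.MathematicalPhysics.QuantumFieldTheory.Balaban1983to89.Node00.TorusCoverPropSixGauge10

/-!
# NODE 00 — THE TORUS→`ℤᵈ` TWIN, FILE 43: [15] (153) ∕ [6] (1.38) FOR THE RECORD's TRANSCRIPTION, ON THE TORUS — dag-n05-d's multiplier form `IsLandau138Z L m η Ω₀ Λs 1 A″`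
# (CENTRED blocking, R2c) for the potential `A″` of the top-anchored lift GIVES print's «`R ∂^{η*} A = 0`» pairing `Σ_y (Δμ)(y)·φ((∂*A)(y)) = 0` for the pushed-down torus potential
# `A`, for every torus test function whose pull-back has vanishing CENTRED block sums — and those block sums ARE NODE 00's `N(Q′)` rows (`TorusCoverLevels`) read through FILE 39's
# anchors (`blockSitesZ (Lʲ) y + (Lᵏ−1)∕2·𝟙 = blockSites (Lʲ) (y + (L^{k−j}−1)∕2·𝟙)`)

Cell `pub-ymgap`, width seat `pub-ymgap-dag-n07-w3` generation 9 (torus push-down lineage), N05-REC road item R7, row (B-153) of the door plan `HOME/pub-ymgap-dag-n07-w3/R7-DOOR-PLAN.md` — the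
centred re-key of this lineage's g0–g2 `Node00.TorusCoverLandau153TestForm.sum_laplace_mul_diverg_eq_zero_of_isLandau138_cover` over dag-n05-d's `B8Eq138LandauFlatOrthogonalRec.
pairing_covLap_eq_zero_of_isLandau138Z` (landed 2026-08-29; consumed BY NAME — my own twin draft was withdrawn as a duplicate).  `--kind proof --supports stmt-QuantumFields-20541` (K0⁷;
count-neutral; THEOREMS ONLY, 0 `def`).  CONSUMED BY NAME, nothing modified: dag-n05-d's `B8Eq138LandauFlatOrthogonalRec` (`pairing_covLap_eq_zero_of_isLandau138Z`, `QTZ_flat_apply`),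
`B8Eq138LandauZdRec` (`IsLandau138Z QTZ`), `B8Eq119TwistedAxialRec` (`flmZ ctrShift_add mem_blockSitesZ_pow_iff_flmZ`), dag-n05-e's `B7SectEFLinearisationRec.blockSitesZ`, lit-balaban's
`B8Eq138LandauZd` (`covLap covDivB`), `B8Ineq159FlatMaps` (`map_indicator map_covLap_indicator_covDivB_flat map_covDivB_flat`), this lineage's `TorusCoverLandau153TestForm` (`covLap_one_eq_laplace_cover`,
`covDivB_one_eq_diverg_cover`, `sum_eq_finsum_cover`), `TorusCoverLandau153.covLap_one_apply`, `TorusCoverPropSixGauge10.covDeriv_one_apply`, dag-n07-e's `TorusCoverLevels`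
(`sum_blockSites_indicator_cover_eq_zero_of_inGauge`, `apply_cover_eq_zero_of_inGauge`, `coverAt`), `TorusCoverGaugeLift` (`cover_add_e cover_sub_e`), `QuantumLattice` (`blockMap blockSites`),
`LatticeFieldCalculus` (`laplace diverg`).  [15] = [Balaban1985Variational]; [6] = [Balaban1985RegularSpaces]; [B6] = [Balaban1984PropagatorsII]; [4] = [Balaban1985BackgroundPropagators]; [I] = [Balaban1987RG1].

WHAT IS PROVED (kernel; standing `Params`; odd `L` where the centred blocks enter; NO estimate).
§1 ★ `mem_blockSitesZ_iff_add_ctrShift_mem_blockSites` (`x ∈ blockSitesZ (Lʲ) y ↔ x + (Lᵏ−1)∕2·𝟙 ∈ blockSites (Lʲ) (y + (L^{k−j}−1)∕2·𝟙)`, `j ≤ k`), `sum_blockSitesZ_add_ctrShift`,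
   ★★ `sum_blockSitesZ_indicator_coverShift_eq_zero_of_inGauge` (for `μ ∈ N(Q′)` of a torus family `D` and `π_j(y + …) ∈ Λ_j(D)`: the CENTRED block sum of the anchored pull-back vanishes —
   `hQ` of the twin's pairing, letter for letter), `indicator_coverShift_eq_zero_of_inGauge` (the `Λ₀` row).
§2 `covLap_one_translate`, `covDivB_one_translate`, ★★ `pairing_covLap_eq_zero_of_isLandau138Z_translate` (the twin's pairing moved to LABEL coordinates: `IsLandau138Z … A″` ⟹
   `Σ_x (Δ^η_1λ)(x)·(𝟙_{Ω₀+t} D^{η*}_1 A″(·−t))(x) = 0` for `λ` with `λ(·+t)` in `N(Q′)` of the twin).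
§3 `map_QTZ_flat`, `isLandau138Z_map_flat` (the twin's (1.38) is preserved by scalar functionals), ★★★ `sum_laplace_mul_diverg_eq_zero_of_isLandau138Z_cover` — THE (153) PAIRING ON THE
   TORUS from the twin's multiplier form: `Σ_{y ∈ T} (Δ_{η⁻¹}μ)(y)·φ((∂*_{η⁻¹}A)(y)) = 0` for the push-down `A` (`A⟨π z, κ⟩ = A″(z − t) κ` on a cover-injective window with a 2-collar), every
   torus `μ` supported over the window whose anchored pull-back has the §1 rows, every `φ : 𝔸 →L[ℂ] ℂ`.
NOT HERE (successor, by-name plumbing unchanged in form from g2–g6): the `D.InGauge μ` ⟹ §1-rows instance (`…InGauge`), `D := cubeDomains` (`…CubeDomains`), and lit-balaban's `RE D η⁻¹ (dsE η⁻¹ a) = 0`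
letter (`…RE`) — exactly as `TorusCoverLandau153InGauge ∕ CubeDomains ∕ RE` sit on `TestForm`; the cube datum of the twin (`CubeB8DZ`, R4∕R0c) fixing `Ω₀, Λs, t`.
HONEST FRAMING: count-neutral helper; lattice ∕ finite-sum bookkeeping between two typings — nothing of [15]∕[6]∕[B6]∕[4]∕[I] analysis asserted or discharged; `HThm4Rec` UNDISCHARGED (caveat
(C-S3-1) stands); N07 ∕ N05 NOT discharged, N07 NOT claimable on road (β); counts unmoved; one finite 𝕋⁴ programme at fixed ε — R4 closes the conditional finite-𝕋⁴ rung `BalabanLadder.UV`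
only; the YM mass gap (Clay) is NOT proved by any of this; nothing continuum ∕ ℝ⁴ ∕ OS.  No `def`, no `sorry`, no `instance`, no `notation`.
-/

set_option autoImplicit false

noncomputable section

open scoped BigOperators Matrix.Norms.L2Operator

namespace Literature.MathematicalPhysics.QuantumFieldTheory.Balaban1983to89.Node00

open B15Eq112TorusCover (cover)
open B14DomainGeom (Pt)
open B7Prop1Explicit (e e_apply)
open BlockAveragingZd (ctrShift)
open B7SectEFLinearisationRec (blockSitesZ)
open B8Eq119TwistedAxialRec (flmZ mem_blockSitesZ_pow_iff_flmZ ctrShift_add)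
open B8Eq138LandauZd (covLap covDivB)
open B8Eq138LandauZdRec (IsLandau138Z)
open B8Eq138LandauFlatOrthogonalRec (pairing_covLap_eq_zero_of_isLandau138Z)
open Literature.MathematicalPhysics.QuantumLattice (blockMap blockSites mem_blockSites_iff)
open LatticeFieldCalculus (laplace diverg)

variable {P : Params}

/-! ## §1  The geometric row: centred `Lʲ`-blocks + the top anchor = NODE 00's label blocks at the level-`j` anchor -/

section Blocks

/-- ★ **THE BLOCK ROW OF THE TOP-ANCHORED DICTIONARY** (odd `L`, `j ≤ k`): `x` lies in the transcription's CENTRED `Lʲ`-block of `y` iff `x + (Lᵏ−1)∕2·𝟙` lies in NODE 00's LABEL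
`Lʲ`-block `Lʲ·y′ + [0, Lʲ)ᵈ` of `y′ = y + (L^{k−j}−1)∕2·𝟙` — n05-d's `c_k = Lʲ·c_{k−j} + c_j` (`ctrShift_add`) and `x ∈ blockSitesZ (Lʲ) y ↔ flmZ L j x = y`.
[cite: Balaban1987RG1, (0.3) p.252; Balaban1985Averaging, (3) p.17] -/
theorem mem_blockSitesZ_iff_add_ctrShift_mem_blockSites {j k : ℕ} (hjk : j ≤ k) (y x : Pt P.d) :
    x ∈ blockSitesZ (P.L ^ j) y ↔
      x + (fun _ => ((ctrShift P.L k : ℕ) : ℤ)) ∈ blockSites (P.L ^ j) (y + fun _ => ((ctrShift P.L (k - j) : ℕ) : ℤ)) := by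
  haveI : NeZero (P.L ^ j) := ⟨pow_ne_zero _ P.L_pos.ne'⟩
  have hL : Odd P.L := P.hL.1
  have hck : ((ctrShift P.L k : ℕ) : ℤ) = (P.L : ℤ) ^ j * ctrShift P.L (k - j) + ctrShift P.L j := by
    have h := ctrShift_add hL (k - j) j
    rwa [Nat.sub_add_cancel hjk] at h
  have hLj : (0 : ℤ) < (P.L : ℤ) ^ j := by have := P.L_pos; positivity
  rw [mem_blockSitesZ_pow_iff_flmZ hL, mem_blockSites_iff]
  constructor
  · intro h
    funext i
    have hi := congrFun h i
    simp only [flmZ] at hi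
    simp only [blockMap, Pi.add_apply, hck, Nat.cast_pow]
    rw [show x i + ((P.L : ℤ) ^ j * ctrShift P.L (k - j) + ctrShift P.L j) = x i + ctrShift P.L j + ctrShift P.L (k - j) * (P.L : ℤ) ^ j by ring,
      Int.add_mul_ediv_right _ _ hLj.ne', hi]
  · intro h
    funext i
    have hi := congrFun h i
    simp only [blockMap, Pi.add_apply, hck, Nat.cast_pow] at hi
    rw [show x i + ((P.L : ℤ) ^ j * ctrShift P.L (k - j) + ctrShift P.L j) = x i + ctrShift P.L j + ctrShift P.L (k - j) * (P.L : ℤ) ^ j by ring,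
      Int.add_mul_ediv_right _ _ hLj.ne'] at hi
    simp only [flmZ]
    exact add_right_cancel hi

/-- Hence a sum of `f(· + (Lᵏ−1)∕2·𝟙)` over the centred block is the sum of `f` over the label block at the level-`j` anchor.
[cite: Balaban1987RG1, (0.3) p.252; Balaban1985Averaging, (3) p.17] -/
theorem sum_blockSitesZ_add_ctrShift {M : Type*} [AddCommMonoid M] {j k : ℕ} (hjk : j ≤ k) (y : Pt P.d) (f : Pt P.d → M) :
    ∑ x ∈ blockSitesZ (P.L ^ j) y, f (x + fun _ => ((ctrShift P.L k : ℕ) : ℤ)) =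
      ∑ x ∈ blockSites (P.L ^ j) (y + fun _ => ((ctrShift P.L (k - j) : ℕ) : ℤ)), f x := by
  refine Finset.sum_nbij' (fun x => x + fun _ => ((ctrShift P.L k : ℕ) : ℤ)) (fun x => x - fun _ => ((ctrShift P.L k : ℕ) : ℤ))
    (fun x hx => (mem_blockSitesZ_iff_add_ctrShift_mem_blockSites hjk y x).mp hx) (fun x hx => ?_) (fun x _ => by simp) (fun x _ => by simp) (fun x _ => rfl)
  rw [mem_blockSitesZ_iff_add_ctrShift_mem_blockSites hjk, sub_add_cancel]
  exact hx

/-- ★★ **THE CENTRED BLOCK-SUM ROW FROM `N(Q′)` OF A TORUS DOMAIN FAMILY**: for a torus test function `μ ∈ N(Q′)` of `D` (`D.InGauge μ`), a transcription level-`j` site `y` whose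
anchored cover `π_j(y + (L^{k−j}−1)∕2·𝟙)` lies in `Λ_j` of `D`, and a window `X ⊇` the label block, the CENTRED block sum of the top-anchored pull-back `X.indicator (μ∘π) (· + (Lᵏ−1)∕2·𝟙)`
over `blockSitesZ (Lʲ) y` VANISHES — the hypothesis `hQ` of dag-n05-d's `pairing_covLap_eq_zero_of_isLandau138Z`, letter for letter (this lineage's `TorusCoverLevels.sum_blockSites_indicator_cover_eq_zero_of_inGauge`
read through §1). [cite: Balaban1984PropagatorsII, (2.7) p.224, (2.10) p.225; Balaban1985RegularSpaces, (1.29) p.81; Balaban1987RG1, (0.3) p.252] -/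
theorem sum_blockSitesZ_indicator_coverShift_eq_zero_of_inGauge (D : B6SectADomainsV1.Domains P) {μ : SiteField P 0 ℝ} (hμ : D.InGauge μ)
    {j k : ℕ} (hjk : j ≤ k) {y : Pt P.d} (hy : D.LamSite j (coverAt P j (y + fun _ => ((ctrShift P.L (k - j) : ℕ) : ℤ))))
    {X : Set (Pt P.d)} (hX : ↑(blockSites (P.L ^ j) (y + fun _ => ((ctrShift P.L (k - j) : ℕ) : ℤ))) ⊆ X) :
    ∑ x ∈ blockSitesZ (P.L ^ j) y, X.indicator (fun z => ((μ (cover P z) : ℝ) : ℂ)) (x + fun _ => ((ctrShift P.L k : ℕ) : ℤ)) = 0 := by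
  rw [sum_blockSitesZ_add_ctrShift hjk y]
  exact sum_blockSites_indicator_cover_eq_zero_of_inGauge D hμ hy hX

/-- The level-`0` row in the same letters: at a transcription site `x` whose anchored cover `π(x + (Lᵏ−1)∕2·𝟙)` lies in `Λ₀`, the pull-back vanishes.
[cite: Balaban1984PropagatorsII, (2.7) p.224; Balaban1987RG1, (0.3) p.252] -/
theorem indicator_coverShift_eq_zero_of_inGauge (D : B6SectADomainsV1.Domains P) {μ : SiteField P 0 ℝ} (hμ : D.InGauge μ) (k : ℕ)
    {x : Pt P.d} (hx : D.LamSite 0 (cover P (x + fun _ => ((ctrShift P.L k : ℕ) : ℤ)))) (X : Set (Pt P.d)) :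
    X.indicator (fun z => ((μ (cover P z) : ℝ) : ℂ)) (x + fun _ => ((ctrShift P.L k : ℕ) : ℤ)) = 0 := by
  by_cases h : (x + fun _ => ((ctrShift P.L k : ℕ) : ℤ)) ∈ X
  · rw [Set.indicator_of_mem h, apply_cover_eq_zero_of_inGauge D hμ hx, Complex.ofReal_zero]
  · rw [Set.indicator_of_notMem h]

end Blocks

/-! ## §2  (1.38) for the TRANSLATED configuration: the centred pairing in label coordinates -/

section Translate

variable {d : ℕ}

/-- `Δ^η_1` of a translated function. [cite: Balaban1985BackgroundPropagators, (3.23) p.394] -/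
theorem covLap_one_translate (η : ℝ) (f : B7Prop1Explicit.Site d → ℂ) (t x : B7Prop1Explicit.Site d) :
    covLap η (1 : B7Prop1Explicit.Site d → Fin d → ℂˣ) (fun y => f (y + t)) x = covLap η (1 : B7Prop1Explicit.Site d → Fin d → ℂˣ) f (x + t) := by
  rw [covLap_one_apply, covLap_one_apply]
  refine Finset.sum_congr rfl fun ν _ => ?_
  rw [show x - e ν + t = x + t - e ν by abel, show x + e ν + t = x + t + e ν by abel]

/-- `D^{η*}_1` of a translated potential. [cite: Balaban1985RegularSpaces, (1.1) p.76] -/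
theorem covDivB_one_translate {𝔸 : Type*} [NormedRing 𝔸] [NormedAlgebra ℂ 𝔸] (η : ℝ) (A : B7Prop1Explicit.Site d → Fin d → 𝔸) (t x : B7Prop1Explicit.Site d) :
    covDivB η (1 : B7Prop1Explicit.Site d → Fin d → 𝔸ˣ) (fun y κ => A (y + t) κ) x = covDivB η (1 : B7Prop1Explicit.Site d → Fin d → 𝔸ˣ) A (x + t) := by
  unfold covDivB
  refine Finset.sum_congr rfl fun κ _ => ?_
  rw [covDeriv_one_apply, covDeriv_one_apply]
  dsimp only
  rw [show x - e κ + t = x + t - e κ by abel]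

/-- ★★ **(1.38) FOR THE RECORD's BLOCKING, STATED ON THE TRANSLATE `A″ = A′(· + t)` (the transcription's coordinates), PAIRS TO ZERO IN LABEL COORDINATES**: if
`IsLandau138Z L m η Ω₀ Λs 1 A″` (odd `L`, finite `Ω₀`) and `λ` (label coordinates) vanishes off `Ω₀ + t` and on `Λ₀ + t` and has vanishing centred block sums
`Σ_{x ∈ blockSitesZ (Lʲ) y} λ(x + t) = 0` on `Λ_j`, then `Σ_x (Δ^η_1λ)(x)·(𝟙_{Ω₀+t} D^{η*}_1 A′)(x) = 0` with `A′ := A″(· − t)` — dag-n05-d's `pairing_covLap_eq_zero_of_isLandau138Z` moved by `t`.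
[cite: Balaban1985RegularSpaces, (1.38) p.82; Balaban1984PropagatorsII, (2.12) p.225; Balaban1987RG1, (0.3) p.252] -/
theorem pairing_covLap_eq_zero_of_isLandau138Z_translate {L m : ℕ} (hL : Odd L) {η : ℝ} {Ω₀ : Set (B7Prop1Explicit.Site d)} (hΩ : Ω₀.Finite)
    {Λs : ℕ → Set (B7Prop1Explicit.Site d)} {A'' : B7Prop1Explicit.Site d → Fin d → ℂ}
    (h : IsLandau138Z L m η Ω₀ Λs (1 : B7Prop1Explicit.Site d → Fin d → ℂˣ) A'') (t : B7Prop1Explicit.Site d)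
    {lam : B7Prop1Explicit.Site d → ℂ} (hsupp : ∀ x, x ∉ Ω₀ → lam (x + t) = 0) (h0 : ∀ x ∈ Λs 0, lam (x + t) = 0)
    (hQ : ∀ j, 1 ≤ j → j ≤ m → ∀ y ∈ Λs j, ∑ x ∈ blockSitesZ (L ^ j) y, lam (x + t) = 0) :
    ∑ᶠ x, covLap η (1 : B7Prop1Explicit.Site d → Fin d → ℂˣ) lam x *
        ((fun y => y + t) '' Ω₀).indicator (covDivB η (1 : B7Prop1Explicit.Site d → Fin d → ℂˣ) (fun y κ => A'' (y - t) κ)) x = 0 := by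
  have key := pairing_covLap_eq_zero_of_isLandau138Z hL hΩ h (lam := fun x => lam (x + t)) hsupp h0 hQ
  rw [← finsum_comp_equiv (Equiv.addRight t)] 
  refine Eq.trans (finsum_congr fun x => ?_) key
  simp only [Equiv.coe_addRight]
  rw [← covLap_one_translate]
  congr 1
  by_cases hx : x ∈ Ω₀
  · have hmem : x + t ∈ (fun y => y + t) '' Ω₀ := ⟨x, hx, rfl⟩
    rw [Set.indicator_of_mem hmem, Set.indicator_of_mem hx, ← covDivB_one_translate]
    simp only [add_sub_cancel_right]
  · have hx' : x + t ∉ (fun y => y + t) '' Ω₀ := fun ⟨y, hy, hyx⟩ => hx (by rwa [← add_right_cancel hyx])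
    rw [Set.indicator_of_notMem hx', Set.indicator_of_notMem hx]

end Translate

/-! ## §3  The (1.38) multiplier form of the twin is preserved by scalar functionals; the pairing ON THE TORUS -/

section Torus

variable {𝔸 : Type*} [NormedRing 𝔸] [NormedAlgebra ℂ 𝔸] [CompleteSpace 𝔸]

/-- `φ` commutes with the centred flat transpose `Q′(1)ᵀ` on multipliers (odd `L`). [cite: Balaban1985BackgroundPropagators, (3.24) p.394; Balaban1985RegularSpaces, (1.29) p.81] -/
theorem map_QTZ_flat {d : ℕ} (φ : 𝔸 →L[ℂ] ℂ) {L : ℕ} (hL : Odd L) (m : ℕ) (Λs : ℕ → Set (B7Prop1Explicit.Site d)) (μ : ℕ → B7Prop1Explicit.Site d → 𝔸)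
    (x : B7Prop1Explicit.Site d) :
    φ (B8Eq138LandauZdRec.QTZ L m Λs (1 : B7Prop1Explicit.Site d → Fin d → 𝔸ˣ) μ x) =
      B8Eq138LandauZdRec.QTZ L m Λs (1 : B7Prop1Explicit.Site d → Fin d → ℂˣ) (fun j z => φ (μ j z)) x := by
  rw [B8Eq138LandauFlatOrthogonalRec.QTZ_flat_apply hL, B8Eq138LandauFlatOrthogonalRec.QTZ_flat_apply hL, map_sum]
  refine Finset.sum_congr rfl fun j _ => ?_
  rw [φ.map_smul_of_tower, B8Ineq159FlatMaps.map_indicator]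

/-- **The twin's (1.38) is preserved by `φ`** (odd `L`): `IsLandau138Z … 1 A ⟹ IsLandau138Z … 1 (φ ∘ A)` with the multiplier `φ ∘ μ` (lit-balaban's `isLandau138_map_flat`, centred).
[cite: Balaban1985RegularSpaces, (1.38) p.82; Balaban1985BackgroundPropagators, (3.25) p.394] -/
theorem isLandau138Z_map_flat {d : ℕ} (φ : 𝔸 →L[ℂ] ℂ) {L m : ℕ} (hL : Odd L) {η : ℝ} {Ω₀ : Set (B7Prop1Explicit.Site d)} {Λs : ℕ → Set (B7Prop1Explicit.Site d)}
    {A : B7Prop1Explicit.Site d → Fin d → 𝔸} (h : IsLandau138Z L m η Ω₀ Λs (1 : B7Prop1Explicit.Site d → Fin d → 𝔸ˣ) A) :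
    IsLandau138Z L m η Ω₀ Λs (1 : B7Prop1Explicit.Site d → Fin d → ℂˣ) (fun z κ => φ (A z κ)) := by
  obtain ⟨μ, hμ⟩ := h
  refine ⟨fun j z => φ (μ j z), fun x hx => ?_⟩
  rw [← B8Ineq159FlatMaps.map_covLap_indicator_covDivB_flat, ← map_QTZ_flat φ hL, hμ x hx]

/-- `(y + e_ν) − e_ν = y` on the torus (local). [folklore] -/
private theorem shift_unshift_self' (y : Site P 0) (ν : Fin P.d) : (y.shift ν).unshift ν = y := by
  funext i
  by_cases hi : i = ν
  · subst hi; simp [Site.shift, Site.unshift]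
  · simp [Site.shift, Site.unshift, hi]

/-- `(y − e_ν) + e_ν = y` on the torus (local). [folklore] -/
private theorem unshift_shift_self' (y : Site P 0) (ν : Fin P.d) : (y.unshift ν).shift ν = y := by
  funext i
  by_cases hi : i = ν
  · subst hi; simp [Site.shift, Site.unshift]
  · simp [Site.shift, Site.unshift, hi]

/-- ★★★ **[15] (153) ∕ [6] (1.38) ON THE TORUS FROM THE TWIN's MULTIPLIER FORM** (the centred re-key of this lineage's `sum_laplace_mul_diverg_eq_zero_of_isLandau138_cover`): let the
transcription's potential `A″` (coordinates of the `ℤᵈ` twin: the lift anchored at `t`, `t = (Lᵏ−1)∕2·𝟙` at the use) satisfy dag-n05-d's `IsLandau138Z L m η Ω₀ Λs 1 A″` (odd `L`, finite `Ω₀`); let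
the torus potential `A` be its push-down on a cover-injective window `X ⊆ Ω₀ + t` of LABEL coordinates (`A ⟨π z, κ⟩ = A″ (z − t) κ`), and `μ` a torus test function supported in `π(S)` with the
2-collar of `S` inside `X`, whose top-anchored pull-back `𝟙_X·(μ∘π)(· + t)` vanishes on `Λ₀` and has vanishing CENTRED block sums over `blockSitesZ (Lʲ) y`, `y ∈ Λ_j`, `1 ≤ j ≤ m` (§1:
these are NODE 00's `N(Q′)` rows).  Then `Σ_{y ∈ T} (Δμ)(y)·φ((∂*A)(y)) = 0` for every continuous linear `φ : 𝔸 → ℂ` — print's «`R ∂^{η*} A = 0`» at the record.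
[cite: Balaban1985Variational, (153) p.301; Balaban1985RegularSpaces, (1.38) p.82; Balaban1984PropagatorsII, (2.12) p.225; Balaban1987RG1, (0.3) p.252] -/
theorem sum_laplace_mul_diverg_eq_zero_of_isLandau138Z_cover {L m : ℕ} (hL : Odd L) {η : ℝ} {Ω₀ : Set (Pt P.d)} (hΩ : Ω₀.Finite)
    {Λs : ℕ → Set (Pt P.d)} {A'' : Pt P.d → Fin P.d → 𝔸}
    (hLan : IsLandau138Z L m η Ω₀ Λs (1 : B7Prop1Explicit.Site P.d → Fin P.d → 𝔸ˣ) A'') (t : Pt P.d)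
    {X : Set (Pt P.d)} (hXΩ : X ⊆ (fun y => y + t) '' Ω₀) (hinj : Set.InjOn (cover P) X)
    {A : PBond P 0 → 𝔸} (hA : ∀ z, z ∈ X → ∀ κ, A ⟨cover P z, κ⟩ = A'' (z - t) κ)
    {μ : Site P 0 → ℂ} {S : Set (Pt P.d)} (hμS : ∀ y, μ y ≠ 0 → y ∈ cover P '' S)
    (hS : ∀ s ∈ S, ∀ z : Pt P.d, (∀ i, |z i - s i| ≤ 2) → z ∈ X)
    (h0 : ∀ x ∈ Λs 0, X.indicator (fun z => μ (cover P z)) (x + t) = 0)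
    (hQ : ∀ j, 1 ≤ j → j ≤ m → ∀ y ∈ Λs j, ∑ x ∈ blockSitesZ (L ^ j) y, X.indicator (fun z => μ (cover P z)) (x + t) = 0)
    (φ : 𝔸 →L[ℂ] ℂ) :
    ∑ y : Site P 0, laplace η⁻¹ μ y * φ (diverg η⁻¹ A y) = 0 := by
  classical
  set lam : Pt P.d → ℂ := X.indicator (fun z => μ (cover P z)) with hlamdef
  have hlamX : ∀ z, z ∈ X → lam z = μ (cover P z) := fun z hz => by rw [hlamdef, Set.indicator_of_mem hz]
  have hlam0 : ∀ z, z ∉ X → lam z = 0 := fun z hz => by rw [hlamdef, Set.indicator_of_notMem hz]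
  set Ω₀' : Set (Pt P.d) := (fun y => y + t) '' Ω₀ with hΩ₀'
  have hΩ' : Ω₀'.Finite := hΩ.image _
  -- the ℤᵈ identity (§2, for `φ ∘ A″`)
  have key := pairing_covLap_eq_zero_of_isLandau138Z_translate hL hΩ (isLandau138Z_map_flat φ hL hLan) t (lam := lam)
    (fun x hx => hlam0 _ fun h => hx (by obtain ⟨y, hy, hyx⟩ := hXΩ h; rwa [← add_right_cancel hyx])) h0 hQ
  rw [← key]
  -- geometry of the sup-ball: the stencil points of a point within distance 1 of `s ∈ S` are within distance 2 of `s`, hence in `X`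
  have habs_e : ∀ (ν i : Fin P.d), |(e ν : Pt P.d) i| ≤ 1 := fun ν i => by
    rw [e_apply]; split_ifs <;> simp
  have hself : ∀ z : Pt P.d, ∀ i, |z i - z i| ≤ 1 := fun z i => by simp
  have hadd : ∀ (z : Pt P.d) (ν i : Fin P.d), |(z + e ν) i - z i| ≤ 1 := fun z ν i => by
    simp only [Pi.add_apply, add_sub_cancel_left]; exact habs_e ν i
  have hsub : ∀ (z : Pt P.d) (ν i : Fin P.d), |(z - e ν) i - z i| ≤ 1 := fun z ν i => by
    simp only [Pi.sub_apply, sub_sub_cancel_left, abs_neg]; exact habs_e ν i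
  have hball : ∀ s ∈ S, ∀ z : Pt P.d, (∀ i, |z i - s i| ≤ 1) → z ∈ X ∧ ∀ ν, z + e ν ∈ X ∧ z - e ν ∈ X := by
    intro s hs z hz
    have h2 : ∀ w : Pt P.d, (∀ i, |w i - z i| ≤ 1) → w ∈ X := fun w hw =>
      hS s hs w fun i => by
        have := abs_sub_le (w i) (z i) (s i)
        linarith [hw i, hz i]
    exact ⟨h2 z (hself z), fun ν => ⟨h2 _ (hadd z ν), h2 _ (hsub z ν)⟩⟩
  set X₁ : Finset (Pt P.d) := hΩ'.toFinset.filter (fun z => ∃ s ∈ S, ∀ i, |z i - s i| ≤ 1) with hX₁def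
  have hmemX₁ : ∀ z, z ∈ X₁ ↔ z ∈ Ω₀' ∧ ∃ s ∈ S, ∀ i, |z i - s i| ≤ 1 := fun z => by
    rw [hX₁def, Finset.mem_filter, Set.Finite.mem_toFinset]
  have hX₁_of_near : ∀ s ∈ S, ∀ z : Pt P.d, (∀ i, |z i - s i| ≤ 1) → z ∈ X₁ := fun s hs z hz =>
    (hmemX₁ z).2 ⟨hXΩ (hball s hs z hz).1, s, hs, hz⟩
  have hX₁X : ∀ z, z ∈ X₁ → z ∈ X := fun z hz => by
    obtain ⟨-, s, hs, hzs⟩ := (hmemX₁ z).1 hz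
    exact (hball s hs z hzs).1
  have hlam_ne : ∀ z, lam z ≠ 0 → z ∈ S := by
    intro z hz
    have hzX : z ∈ X := by by_contra h; exact hz (hlam0 z h)
    rw [hlamX z hzX] at hz
    obtain ⟨s, hs, hsz⟩ := hμS _ hz
    have hsX : s ∈ X := (hball s hs s (hself s)).1
    rwa [← hinj hsX hzX hsz]
  refine sum_eq_finsum_cover (X₁ := X₁) (fun x hx x' hx' h => hinj (hX₁X x hx) (hX₁X x' hx') h) ?_ ?_ ?_
  · intro x hx
    have hz0 : ∀ w : Pt P.d, (∀ i, |x i - w i| ≤ 1) → lam w = 0 := fun w hw => by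
      by_contra h; exact hx (hX₁_of_near w (hlam_ne w h) x hw)
    have hx0 : lam x = 0 := hz0 x (hself x)
    have hx1 : ∀ ν, lam (x + e ν) = 0 := fun ν => hz0 _ fun i => by
      simp only [Pi.add_apply, sub_add_cancel_left, abs_neg]; exact habs_e ν i
    have hx2 : ∀ ν, lam (x - e ν) = 0 := fun ν => hz0 _ fun i => by
      simp only [Pi.sub_apply, sub_sub_cancel]; exact habs_e ν i
    rw [covLap_one_apply]
    simp only [hx0, hx1, hx2, sub_self, smul_zero, Finset.sum_const_zero, zero_mul]
  · intro x hx
    obtain ⟨hxΩ, s, hs, hxs⟩ := (hmemX₁ x).1 hx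
    obtain ⟨hxX, hν⟩ := hball s hs x hxs
    rw [covLap_one_eq_laplace_cover η hlamX hxX hν, Set.indicator_of_mem hxΩ, ← B8Ineq159FlatMaps.map_covDivB_flat φ,
      covDivB_one_eq_diverg_cover η hA hxX fun κ => (hν κ).2]
  · intro y hy
    have himg : ∀ z, z ∈ X₁ → cover P z = y → False := fun z hz hzy => hy (Finset.mem_image.2 ⟨z, hz, hzy⟩)
    have hy0 : μ y = 0 := by
      by_contra h
      obtain ⟨s, hs, hsy⟩ := hμS y h
      exact himg s (hX₁_of_near s hs s (hself s)) hsy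
    have hy1 : ∀ ν, μ (y.shift ν) = 0 := fun ν => by
      by_contra h
      obtain ⟨s, hs, hsy⟩ := hμS _ h
      refine himg (s - e ν) (hX₁_of_near s hs _ (hsub s ν)) ?_
      rw [cover_sub_e, hsy, shift_unshift_self']
    have hy2 : ∀ ν, μ (y.unshift ν) = 0 := fun ν => by
      by_contra h
      obtain ⟨s, hs, hsy⟩ := hμS _ h
      refine himg (s + e ν) (hX₁_of_near s hs _ (hadd s ν)) ?_
      rw [cover_add_e, hsy, unshift_shift_self']
    have hlap : laplace η⁻¹ μ y = 0 := by
      unfold laplace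
      simp only [hy0, hy1, hy2, add_zero, sub_self, smul_zero, Finset.sum_const_zero]
    rw [hlap, zero_mul]

end Torus

end Literature.MathematicalPhysics.QuantumFieldTheory.Balaban1983to89.Node00

end
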